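import Literature.Analysis.Distribution.NormalJetFieldCalculus
import Mathlib.LinearAlgebra.Multilinear.FiniteDimensional
import Mathlib.LinearAlgebra.Dual.Lemmas
import Mathlib.Topology.Algebra.Module.FiniteDimension
import Mathlib.RingTheory.Finiteness.Basic
import HarnessLib

/-!
# Symmetric multilinear forms lie in the span of powers of linear forms

Topic `Analysis/Distribution`; namespace `Literature.Analysis.Distribution`. A classical lemma of
multilinear algebra used in the symbol calculus of `NormalSymbolDescentSecondOrder`: on a
finite-dimensional real space `B`, every *symmetric* `j`-linear form `m : B^j → ℂ` belongs to every
complex subspace of `NormalJetSpace B j` containing the `j`-th powers `v ↦ Π_i ℓ(v_i)` of all real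
linear forms `ℓ` (`mem_of_forall_powForm_mem`).

Proof (coordinate-light): the power map `ℓ ↦ ℓ^{⊗j}` is the diagonal of the continuous multilinear
map `(ℓ_1, …, ℓ_j) ↦ ℓ_1 ⊗ ⋯ ⊗ ℓ_j`, so its `j`-th derivative is the symmetrised product
(`ContinuousMultilinearMap.iteratedFDeriv_comp_diagonal`); derivatives of a map with values in a
(closed) subspace stay in it (dual separation in finite dimension); and a symmetric form is the
symmetrisation of its expansion in products of coordinate forms.

* §1 `NormalJetSpace B j` is finite-dimensional;
* §2 product forms `prodForm`, power forms `powForm`, and the multilinear map `prodFormML`;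
* §3 symmetrised products lie in any subspace containing all powers;
* §4 the expansion of a form in a basis and the main lemma.

Everything is proved; no named fact is introduced.

## References

* L. Hörmander, *The Analysis of Linear Partial Differential Operators I* (1983), §3.1 (polarization)
  [HormanderALPDO1]; folklore multilinear algebra.
-/

noncomputable section

open Set Function
open scoped ContDiff

namespace Literature.Analysis.Distribution

variable {B : Type*} [NormedAddCommGroup B] [NormedSpace ℝ B]

/-! ### 1. Finite-dimensionality of the jet spaces -/

section FinDim

variable [FiniteDimensional ℝ B]

/-- `NormalJetSpace B j` is finite-dimensional over `ℝ` (it embeds in the multilinear maps). [folklore] -/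
instance instFiniteDimensionalNormalJetSpace (j : ℕ) : FiniteDimensional ℝ (NormalJetSpace B j) :=
  Module.Finite.of_injective
    (ContinuousMultilinearMap.toMultilinearMapLinear (R' := ℝ) (A := ℝ) (M₁ := fun _ : Fin j => B) (M₂ := ℂ))
    ContinuousMultilinearMap.toMultilinearMap_injective

/-- `NormalJetSpace B j` is finite-dimensional over `ℂ`. [folklore] -/
instance instFiniteDimensionalComplexNormalJetSpace (j : ℕ) : FiniteDimensional ℂ (NormalJetSpace B j) :=
  Module.Finite.of_restrictScalars_finite ℝ ℂ (NormalJetSpace B j)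

end FinDim

/-! ### 2. Product and power forms -/

section Forms

/-- **Product form** `prodForm ℓ (v) = Π_k ℓ_k(v_k)`. [folklore] -/
def prodForm {j : ℕ} (ℓ : Fin j → B →L[ℝ] ℝ) : NormalJetSpace B j :=
  (ContinuousMultilinearMap.mkPiAlgebra ℝ (Fin j) ℂ).compContinuousLinearMap fun k => Complex.ofRealCLM.comp (ℓ k)

/-- `prodForm ℓ v = Π_k ℓ_k(v_k)`. [folklore] -/
@[simp] theorem prodForm_apply {j : ℕ} (ℓ : Fin j → B →L[ℝ] ℝ) (v : Fin j → B) :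
    prodForm ℓ v = ∏ k, ((ℓ k (v k) : ℝ) : ℂ) := by
  simp [prodForm, ContinuousMultilinearMap.compContinuousLinearMap_apply, ContinuousMultilinearMap.mkPiAlgebra_apply]

/-- **Power form** `powForm j ℓ (v) = Π_k ℓ(v_k)`. [folklore] -/
def powForm (j : ℕ) (ℓ : B →L[ℝ] ℝ) : NormalJetSpace B j := prodForm fun _ => ℓ

/-- `powForm j ℓ v = Π_k ℓ(v_k)`. [folklore] -/
@[simp] theorem powForm_apply (j : ℕ) (ℓ : B →L[ℝ] ℝ) (v : Fin j → B) :
    powForm j ℓ v = ∏ k, ((ℓ (v k) : ℝ) : ℂ) := by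
  simp [powForm]

/-- Power forms are symmetric. [folklore] -/
theorem powForm_comp_perm (j : ℕ) (ℓ : B →L[ℝ] ℝ) (v : Fin j → B) (σ : Equiv.Perm (Fin j)) :
    powForm j ℓ (v ∘ σ) = powForm j ℓ v := by
  simp only [powForm_apply, Function.comp_apply]
  exact Equiv.prod_comp σ (fun k => ((ℓ (v k) : ℝ) : ℂ))

/-- Reindexing a product form. [folklore] -/
theorem prodForm_domDomCongr {j : ℕ} (ℓ : Fin j → B →L[ℝ] ℝ) (σ : Equiv.Perm (Fin j)) :
    (prodForm ℓ).domDomCongr σ = prodForm (ℓ ∘ σ.symm) := by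
  ext v
  simp only [ContinuousMultilinearMap.domDomCongr_apply, prodForm_apply, Function.comp_apply]
  exact (Equiv.prod_comp σ.symm (fun k => ((ℓ k (v (σ k)) : ℝ) : ℂ))).symm.trans (by simp)

/-- **The product form as a continuous multilinear map of the linear forms.** [folklore] -/
def prodFormML (j : ℕ) : ContinuousMultilinearMap ℝ (fun _ : Fin j => B →L[ℝ] ℝ) (NormalJetSpace B j) :=
  (((ContinuousLinearMap.apply ℝ (NormalJetSpace B j) (ContinuousMultilinearMap.mkPiAlgebra ℝ (Fin j) ℂ)).compContinuousMultilinearMap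
    (ContinuousMultilinearMap.compContinuousLinearMapContinuousMultilinear ℝ (fun _ : Fin j => B) (fun _ : Fin j => ℂ) ℂ)).compContinuousLinearMap
      fun _ => ContinuousLinearMap.compL ℝ B ℝ ℂ Complex.ofRealCLM)

/-- `prodFormML j ℓ = prodForm ℓ`. [folklore] -/
@[simp] theorem prodFormML_apply (j : ℕ) (ℓ : Fin j → B →L[ℝ] ℝ) : prodFormML j ℓ = prodForm ℓ := rfl

/-- The power form is the diagonal of `prodFormML`. [folklore] -/
theorem powForm_eq_diag (j : ℕ) (ℓ : B →L[ℝ] ℝ) : powForm j ℓ = prodFormML j (fun _ => ℓ) := rfl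

end Forms

/-! ### 3. Symmetrised products lie in any subspace containing the powers -/

section Span

variable [FiniteDimensional ℝ B]

/-- **Symmetrised products of linear forms lie in every complex subspace containing all power forms**
(differentiate the power map `j` times and separate by a functional). [folklore] -/
theorem sum_prodForm_comp_perm_mem {j : ℕ} (M : Submodule ℂ (NormalJetSpace B j)) (hM : ∀ ℓ : B →L[ℝ] ℝ, powForm j ℓ ∈ M)
    (ℓ : Fin j → B →L[ℝ] ℝ) : (∑ σ : Equiv.Perm (Fin j), prodForm (fun i => ℓ (σ i))) ∈ M := by
  by_contra hx
  obtain ⟨f, hfx, hfM⟩ := Submodule.exists_dual_map_eq_bot_of_notMem hx inferInstance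
  -- `f` kills `M`
  have hf0 : ∀ m ∈ M, f m = 0 := fun m hm => by
    have : f m ∈ M.map f := Submodule.mem_map_of_mem hm
    rwa [hfM, Submodule.mem_bot] at this
  -- make `f` continuous (finite dimension) and real
  set ψ : NormalJetSpace B j →L[ℝ] ℂ := (LinearMap.toContinuousLinearMap f).restrictScalars ℝ with hψ
  have hψf : ∀ m, ψ m = f m := fun m => rfl
  -- the power map and its `j`-th derivative
  set F : (B →L[ℝ] ℝ) → NormalJetSpace B j := fun x => prodFormML j (fun _ => x) with hF
  have hFval : ∀ x, F x ∈ M := fun x => by rw [hF]; exact hM x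
  have hψF : ψ ∘ F = fun _ => 0 := funext fun x => by simp only [Function.comp_apply, hψf, hf0 _ (hFval x)]
  have hsmooth : ContDiff ℝ ∞ F := (prodFormML (B := B) j).contDiff.comp (contDiff_pi.2 fun _ => contDiff_id)
  have h1 := ψ.iteratedFDeriv_comp_left (hsmooth.contDiffAt (x := 0)) (i := j) (mod_cast le_top)
  rw [hψF, iteratedFDeriv_fun_zero] at h1
  have h2 := congrArg (fun T => T ℓ) h1
  simp only [Pi.zero_apply, zero_apply, ContinuousLinearMap.compContinuousMultilinearMap_coe,
    Function.comp_apply] at h2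
  rw [hF, ContinuousMultilinearMap.iteratedFDeriv_comp_diagonal] at h2
  simp only [prodFormML_apply] at h2
  exact hfx (by rw [← hψf]; exact h2.symm)

end Span

/-! ### 4. Expansion in a basis and the main lemma -/

section Main

variable [FiniteDimensional ℝ B]

/-- The coordinate forms of `Module.finBasis ℝ B` as continuous linear forms. [folklore] -/
def coordForm (i : Fin (Module.finrank ℝ B)) : B →L[ℝ] ℝ :=
  LinearMap.toContinuousLinearMap ((Module.finBasis ℝ B).coord i)

/-- `coordForm i b = (finBasis).repr b i`. [folklore] -/
@[simp] theorem coordForm_apply (i : Fin (Module.finrank ℝ B)) (b : B) :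
    coordForm i b = (Module.finBasis ℝ B).repr b i := by
  simp [coordForm]

/-- **Expansion of a multilinear form in products of coordinate forms**:
`m = Σ_r m(e_{r_1}, …, e_{r_j}) • x_{r_1} ⊗ ⋯ ⊗ x_{r_j}`. [folklore] -/
theorem eq_sum_smul_prodForm {j : ℕ} (m : NormalJetSpace B j) :
    m = ∑ r : Fin j → Fin (Module.finrank ℝ B),
      m (fun k => (Module.finBasis ℝ B) (r k)) • prodForm (fun k => coordForm (B := B) (r k)) := by
  ext v
  have hv : v = fun k => ∑ i, (coordForm i (v k)) • (Module.finBasis ℝ B) i := by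
    funext k; simp [(Module.finBasis ℝ B).sum_repr (v k)]
  conv_lhs => rw [hv]
  rw [ContinuousMultilinearMap.map_sum m (fun k i => (coordForm i (v k)) • (Module.finBasis ℝ B) i), sum_apply]
  refine Finset.sum_congr rfl fun r _ => ?_
  rw [show (fun k => coordForm (r k) (v k) • (Module.finBasis ℝ B) (r k)) =
      fun k => (fun k => coordForm (r k) (v k)) k • (fun k => (Module.finBasis ℝ B) (r k)) k from rfl,
    ContinuousMultilinearMap.map_smul_univ, smul_apply, prodForm_apply, smul_eq_mul, Complex.real_smul, mul_comm]
  push_cast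
  rfl

/-- **Symmetric forms lie in every complex subspace containing all power forms.** [folklore] -/
theorem mem_of_forall_powForm_mem {j : ℕ} (M : Submodule ℂ (NormalJetSpace B j)) (hM : ∀ ℓ : B →L[ℝ] ℝ, powForm j ℓ ∈ M)
    {m : NormalJetSpace B j} (hm : ∀ (v : Fin j → B) (σ : Equiv.Perm (Fin j)), m (v ∘ σ) = m v) : m ∈ M := by
  rw [← symmetrize_eq_self_of_forall_comp_perm hm, symmetrize]
  refine Submodule.smul_mem _ _ ?_
  have hdd : ∀ σ : Equiv.Perm (Fin j), m.domDomCongr σ = ∑ r : Fin j → Fin (Module.finrank ℝ B),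
      m (fun k => (Module.finBasis ℝ B) (r k)) • (prodForm fun k => coordForm (B := B) (r k)).domDomCongr σ := by
    intro σ
    conv_lhs => rw [eq_sum_smul_prodForm m]
    ext v
    simp [sum_apply]
  simp_rw [hdd]
  rw [Finset.sum_comm]
  refine Submodule.sum_mem _ fun r _ => ?_
  simp_rw [← Finset.smul_sum]
  refine Submodule.smul_mem _ _ ?_
  have h1 : ∀ σ : Equiv.Perm (Fin j), (prodForm fun k => coordForm (B := B) (r k)).domDomCongr σ =
      prodForm fun k => coordForm (B := B) (r (σ.symm k)) := fun σ => prodForm_domDomCongr _ σ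
  simp_rw [h1]
  have h2 : (∑ σ : Equiv.Perm (Fin j), prodForm fun k => coordForm (B := B) (r (σ.symm k))) =
      ∑ σ : Equiv.Perm (Fin j), prodForm fun k => coordForm (B := B) (r (σ k)) :=
    Fintype.sum_equiv (Equiv.inv (Equiv.Perm (Fin j))) _ _ fun σ => by
      simp [Equiv.Perm.inv_def]
  rw [h2]
  exact sum_prodForm_comp_perm_mem M hM fun k => coordForm (B := B) (r k)

end Main


end Literature.Analysis.Distribution
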